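import Summits.MatrixMultiplication.OmegaCensus.SmallFormats.MatMul225FramePlaneCap
import Summits.MatrixMultiplication.OmegaCensus.SmallFormats.MatMul225GF3FrameCapCertificatePart0
import Summits.MatrixMultiplication.OmegaCensus.SmallFormats.MatMul225GF3FrameCapCertificatePart1
import Summits.MatrixMultiplication.OmegaCensus.SmallFormats.MatMul225GF3FrameCapCertificatePart2
import Mathlib.Tactic.Linarith
import HarnessLib

/-!
# ω-census family (a): count certificate at `(5, 17)` with invertible-line cap `6` AND the frame plane cap `2` — main file (3 part files) (generated; tensor g35/g36 pipeline, g37 clause)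

Cell `pub-omega` (unit `pub-omega-tensor`), topic `Summits/MatrixMultiplication/OmegaCensus` (sub-folder `SmallFormats`). Framing
(verbatim): lottery ticket; floor = certified bounds/negative ranges. HONEST FRAMING: a branch-and-bound / Farkas certificate
(429 nodes, 215 leaves; exact rational LP on kit, bundle kitjob-bbplus of tensor g36 = tensor g35's kit-j318794 pipeline) that NO count
vector over tensor g31's 40 classes satisfies the J/Q-plane clauses of `XCaps3 5 17`, the ROWS/COLUMNS clauses at the ALEKSEEV-FRAME cap 2
(`MatMul225FramePlaneCap`, tensor g37: `load_rowcol_le_two`), the invertible lines capped at 6 (half law plus one) and total 17;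
each leaf is closed by `linarith` from the listed clause loads (pipeline `tensorRank_225_gf3_eq_of_count_certificate2`). Nothing on `ω`.
-/

namespace Summit.MatrixMultiplication.OmegaCensus.SmallFormats.Enum723

open Finset

set_option maxHeartbeats 8000000 in
/-- **No count vector at `(5, 17)` with invertible cap `6`.** -/
theorem no_adm517cap6rc2 (c : ℕ → ℕ) (hJ : ∀ k, k < 32 → load c k + 3 * 5 ≤ 17)
    (hRC : ∀ k, 32 ≤ k → k < 40 → load c k ≤ 2) (hQ : ∀ k, 40 ≤ k → k < 58 → load c k + 3 * 5 ≤ 17)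
    (hL : ∀ k, 58 ≤ k → k < 82 → load c k ≤ 6) (ht : tot c = 17) : False := by
  rcases Nat.lt_or_ge (c 1) 1 with hub1_0 | hlb1_1
  · rcases Nat.lt_or_ge (c 0) 1 with hub0_0 | hlb0_1
    · exact no_adm517cap6rc2_part0 c hJ hRC hQ hL ht hub1_0 hub0_0
    · exact no_adm517cap6rc2_part1 c hJ hRC hQ hL ht hub1_0 hlb0_1
  · exact no_adm517cap6rc2_part2 c hJ hRC hQ hL ht hlb1_1

/-- **`R_𝔽₃(⟨2,2,5⟩) = 18`** — the certificate through `tensorRank_225_gf3_eq_of_count_certificate2` (frame plane cap 2, invertible cap 6, Hopcroft–Kerr upper bound). -/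
theorem tensorRank_225_gf3 : Literature.Computability.AlgebraicComplexity.tensorRank
    (Literature.Computability.AlgebraicComplexity.matMulTensor (ZMod 3) 2 2 5) = 18 :=
  tensorRank_225_gf3_eq_of_count_certificate2 no_adm517cap6rc2

end Summit.MatrixMultiplication.OmegaCensus.SmallFormats.Enum723
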